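import Literature.NumberTheory.LFunctions.XiLadderTailInputs
import Literature.NumberTheory.LFunctions.XiLadderBulkMoments
import Literature.NumberTheory.LFunctions.XiLadderFaceSixteen
import Literature.NumberTheory.LFunctions.XiLadderTwoPieceFloor
import Literature.NumberTheory.LFunctions.XiTiltedPotential
import Literature.NumberTheory.LFunctions.JensenXiLadderBoxFive
import HarnessLib

/-!
# THEOREM A for `d = 5` from `n = 2·10⁵`: the ladder box `B₅(3/25, 1/190)` height-free, and
# `JensenHyperbolicFrom ξ 5 200000` unconditionally

`Literature/NumberTheory/LFunctions/`. Third row of the Jensen track's THEOREM A (eng-3, LADDER-BL.md;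
design HOME/jensen/p1/THEOREM-A-ASSEMBLY.md v0.3 (E); ruling J-R11 (b)): for every `n ≥ 2·10⁵`,

  `LadderMomentBounds 5 blLadderConst (3/25) (1/190) n`     (`ladderMomentBounds_five_of_ge`),

whence, by p2's kernel-certified degree-5 box (`jensenHyperbolicFrom_five_of_ladderMomentBounds_from`),

  `JensenHyperbolicFrom xiTaylorCoeff 5 200000`     (`jensenHyperbolicFrom_xi_five_twoHundredThousand`).

Same template as `XiLadderRowSix.lean` (two-piece floor, faces via `xi_face_bound_sixteen` with `m = 3/25`,
`3 ≤ l ≤ 10`); mode bracket `a ≥ 19/8` (`e^{19/2} < 8103.084·1.64873`, the factor `e^{1/2} < 1.64873`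
from `(e^{1/2})² = e < 1.64873²`); the polynomial-vs-exponential step uses `t⁷⁰/70! ≤ eᵗ` (`t ≥ 123.9`).

References: Griffin–Ono–Rolen–Zagier, PNAS 116 (2019), Thm 7 / §5.1 and Thm 3 [GORZPNAS2019];
Brascamp–Lieb, J. Funct. Anal. 22 (1976), Thms 4.1, 5.1 [BrascampLieb1976].
-/

noncomputable section

open MeasureTheory Set Filter Finset
open scoped Topology Nat BigOperators

namespace Literature.NumberTheory.LFunctions

open Literature.Probability.Distributions

/-! ### Elementary lemmas -/

/-- `i! ≤ n^i` for `i ≤ n`. [folklore] -/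
private theorem factorial_le_pow_of_le' {i n : ℕ} (h : i ≤ n) : ((i ! : ℕ) : ℝ) ≤ (n : ℝ) ^ i := by
  induction i with
  | zero => simp
  | succ j ih =>
    have hj : j ≤ n := Nat.le_of_succ_le h
    have hj1 : ((j : ℝ) + 1) ≤ n := by exact_mod_cast h
    rw [Nat.factorial_succ, Nat.cast_mul, pow_succ]
    calc ((j + 1 : ℕ) : ℝ) * (j ! : ℝ) ≤ (n : ℝ) * (n : ℝ) ^ j := by
          push_cast
          exact mul_le_mul hj1 (ih hj) (by positivity) (by positivity)
      _ = (n : ℝ) ^ j * n := by ring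

/-- The shifted-moment tail sum is at most `(c + l/β)^l/β`. [folklore] -/
private theorem tailSum_le (l : ℕ) {c β : ℝ} (hc : 0 ≤ c) (hβ : 0 < β) :
    ∑ m ∈ range (l + 1), c ^ m * ((((l - m) ! : ℕ) : ℝ) / β ^ (l - m + 1)) * (l.choose m : ℝ) ≤
      (c + l / β) ^ l / β := by
  rw [add_pow, Finset.sum_div]
  refine Finset.sum_le_sum fun m hm => ?_
  have hml : m ≤ l := Nat.lt_succ_iff.1 (Finset.mem_range.1 hm)
  have hfac : (((l - m) ! : ℕ) : ℝ) ≤ (l : ℝ) ^ (l - m) := factorial_le_pow_of_le' (Nat.sub_le l m)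
  have h1 : (((l - m) ! : ℕ) : ℝ) / β ^ (l - m + 1) ≤ ((l : ℝ) / β) ^ (l - m) / β := by
    rw [div_pow, pow_succ, div_div]
    exact div_le_div_of_nonneg_right hfac (by positivity)
  calc c ^ m * ((((l - m) ! : ℕ) : ℝ) / β ^ (l - m + 1)) * (l.choose m : ℝ)
      ≤ c ^ m * (((l : ℝ) / β) ^ (l - m) / β) * (l.choose m : ℝ) := by
        gcongr
    _ = c ^ m * ((l : ℝ) / β) ^ (l - m) * (l.choose m : ℝ) / β := by ring

/-- `(√R)^{2j} = R^j` for `R ≥ 0`. [folklore] -/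
private theorem sqrt_pow_two_mul {R : ℝ} (hR : 0 ≤ R) (j : ℕ) : Real.sqrt R ^ (2 * j) = R ^ j := by
  rw [pow_mul, Real.sq_sqrt hR]

/-! ### The row -/

set_option maxHeartbeats 4000000 in
/-- **THEOREM A, row `d = 5`, threshold `2·10⁵` (height-free).** For every `n ≥ 2·10⁵` the moment
vector of `ν_{2n} ∝ u^{2n}Φ(u)du` lies in the ladder box `B₅(3/25, 1/190)` with the Brascamp–Lieb
constant table (`3 ≤ l ≤ 10`). [cite: GORZPNAS2019, Thm 7 and §5.1] -/
theorem ladderMomentBounds_five_of_ge (n : ℕ) (hn : 200000 ≤ n) :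
    LadderMomentBounds 5 blLadderConst (3 / 25) (1 / 190) n := by
  have hπ := Real.pi_gt_d6
  have hπ' := Real.pi_lt_d6
  have hπ0 : 0 < Real.pi := Real.pi_pos
  have hn' : (200000 : ℝ) ≤ n := by exact_mod_cast hn
  have hcast : ((2 * n : ℕ) : ℝ) = 2 * (n : ℝ) := by push_cast; ring
  ---------------------------------------------------------------- Step A: the mode (`a ≥ 19/8`)
  have he : 13167 < Real.exp (19 / 2) ∧ Real.exp (19 / 2) < 13360 := by
    have e : Real.exp (19 / 2) = Real.exp 9 * Real.exp (1 / 2) := by rw [← Real.exp_add]; norm_num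
    have e9 : Real.exp 9 = Real.exp 1 ^ 9 := by rw [← Real.exp_nat_mul]; norm_num
    have h9lt : Real.exp 9 < 8103.084 := by
      rw [e9]; calc Real.exp 1 ^ 9 < 2.7182818286 ^ 9 :=
          pow_lt_pow_left₀ Real.exp_one_lt_d9 (Real.exp_pos 1).le (by norm_num)
        _ < 8103.084 := by norm_num
    have h9gt : 8103.08 < Real.exp 9 := by
      rw [e9]; calc (8103.08 : ℝ) < 2.7182818283 ^ 9 := by norm_num
        _ < Real.exp 1 ^ 9 := pow_lt_pow_left₀ Real.exp_one_gt_d9 (by norm_num) (by norm_num)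
    have hhalf_le : Real.exp (1 / 2) < 1.64873 := by
      have hsq : Real.exp (1 / 2) ^ 2 < 1.64873 ^ 2 := by
        rw [← Real.exp_nat_mul, show ((2 : ℕ) : ℝ) * (1 / 2) = 1 by norm_num]
        calc Real.exp 1 < 2.7182818286 := Real.exp_one_lt_d9
          _ < 1.64873 ^ 2 := by norm_num
      exact lt_of_pow_lt_pow_left₀ 2 (by norm_num) hsq
    have hhalf_ge : (13 : ℝ) / 8 ≤ Real.exp (1 / 2) := by
      have := Real.quadratic_le_exp_of_nonneg (show (0 : ℝ) ≤ 1 / 2 by norm_num); linarith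
    rw [e]
    constructor <;> nlinarith [Real.exp_pos (9 : ℝ), Real.exp_pos (1 / 2 : ℝ)]
  obtain ⟨he_lo, he_hi⟩ := he
  have hbr : 4 * Real.pi * Real.exp (4 * (19 / 8 : ℝ)) - 9 < ((2 * n : ℕ) : ℝ) / (19 / 8) := by
    rw [hcast, show (4 : ℝ) * (19 / 8) = 19 / 2 by norm_num]
    have h1 : Real.pi * Real.exp (19 / 2) < 3.141593 * 13360 :=
      mul_lt_mul'' hπ' he_hi hπ0.le (Real.exp_pos _).le
    have h2 : (3200000 / 19 : ℝ) ≤ 2 * (n : ℝ) / (19 / 8) := by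
      rw [le_div_iff₀ (by norm_num : (0 : ℝ) < 19 / 8)]; linarith
    have h3 : (4 : ℝ) * (3.141593 * 13360) - 9 < 3200000 / 19 := by norm_num
    linarith
  obtain ⟨a, hαa, hmode⟩ := exists_xi_mode_ge (2 * n) (by norm_num : (0 : ℝ) < 19 / 8) hbr
  rw [hcast] at hmode
  have ha : 0 < a := by linarith
  have hαa' : (17 : ℝ) / 8 ≤ a := by linarith
  ---------------------------------------------------------------- `Y`, the two-piece rate `R`
  set Y : ℝ := Real.pi * Real.exp (4 * a) with hY
  have hY0 : 0 < Y := by positivity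
  have hYlo : 41300 ≤ Y := by
    have h1 : Real.exp (19 / 2) ≤ Real.exp (4 * a) := Real.exp_le_exp.2 (by linarith)
    have h2 : (3.141592 : ℝ) * 13167 ≤ Real.pi * Real.exp (4 * a) :=
      mul_le_mul hπ.le (by linarith) (by norm_num) hπ0.le
    rw [hY]; linarith
  set cc : ℝ := a + 1 / (16 * a) with hcc
  have hcc0 : 0 < cc := by rw [hcc]; positivity
  set Re : ℝ := 16 * Real.pi * Real.exp (4 * (a - 1 / 40)) with hRe
  set R : ℝ := 2 * (n : ℝ) / cc ^ 2 + Re with hR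
  have hexp_tenth : (9 : ℝ) / 10 ≤ Real.exp (-(1 / 10)) := by
    have h := Real.add_one_le_exp (-(1 / 10) : ℝ); linarith
  have hexp_tenth' : Real.exp (-(1 / 10)) ≤ 1 := by
    rw [show (1 : ℝ) = Real.exp 0 by simp]; exact Real.exp_le_exp.2 (by norm_num)
  have eRe : Re = 16 * Y * Real.exp (-(1 / 10)) := by
    have e1 : Real.exp (4 * (a - 1 / 40)) = Real.exp (4 * a) * Real.exp (-(1 / 10)) := by
      rw [← Real.exp_add]; congr 1; ring
    rw [hRe, e1, hY]; ring
  have hRege : (144 / 10) * Y ≤ Re := by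
    rw [eRe]; have := mul_le_mul_of_nonneg_left hexp_tenth (by positivity : (0 : ℝ) ≤ 16 * Y); linarith
  have hRele : Re ≤ 16 * Y := by
    rw [eRe]; have := mul_le_mul_of_nonneg_left hexp_tenth' (by positivity : (0 : ℝ) ≤ 16 * Y); linarith
  have hRe0 : 0 < Re := by positivity
  have hkc0 : 0 ≤ 2 * (n : ℝ) / cc ^ 2 := by positivity
  have hReR : Re ≤ R := by rw [hR]; linarith
  have hRge : (144 / 10) * Y ≤ R := hRege.trans hReR
  have hR0 : 0 < R := by linarith
  have hRlo : 219081 ≤ R := by linarith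
  ---------------------------------------------------------------- `2n + 1 ≤ 4aY`
  have hkY : 2 * (n : ℝ) + 1 ≤ 4 * a * Y := by
    have henv := neg_deBruijnPhiDeriv_div_le ha.le
    have e : -deBruijnPhiDeriv a / deBruijnPhi a = -(deBruijnPhiDeriv a / deBruijnPhi a) := neg_div _ _
    have h2 : 2 * (n : ℝ) / a ≤ 4 * Real.pi * Real.exp (4 * a) - 9 := by linarith
    rw [div_le_iff₀ ha] at h2
    have e2 : (4 * Real.pi * Real.exp (4 * a) - 9) * a = 4 * a * Y - 9 * a := by rw [hY]; ring
    rw [e2] at h2; linarith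
  have hk : 2 * (n : ℝ) ≤ 4 * a * Y := by linarith
  have hkc : 2 * (n : ℝ) / cc ^ 2 ≤ (32 / 19) * Y := by
    have h16a : (0 : ℝ) ≤ 1 / (16 * a) := by positivity
    have hca : a ≤ cc := by rw [hcc]; linarith
    have h1 : 2 * (n : ℝ) / cc ^ 2 ≤ 4 * a * Y / a ^ 2 :=
      div_le_div₀ (by positivity) hk (by positivity) (pow_le_pow_left₀ ha.le hca 2)
    have h2 : 4 * a * Y / a ^ 2 = 4 * Y / a := by field_simp
    have h3 : 4 * Y / a ≤ 4 * Y / (19 / 8) := div_le_div_of_nonneg_left (by positivity) (by norm_num) hαa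
    rw [h2] at h1; linarith
  have hRle : R ≤ (177 / 10) * Y := by rw [hR]; linarith
  ---------------------------------------------------------------- floors (written-out `W″`)
  have hfloor : ∀ u : ℝ, 0 < u → a - 1 / 40 ≤ u → R ≤ 2 * (n : ℝ) / u ^ 2 +
      (deBruijnPhiDeriv u ^ 2 - deBruijnPhi u * deBruijnPhiDeriv₂ u) / deBruijnPhi u ^ 2 := by
    intro u hu hbu
    have hk' : ((2 * n : ℕ) : ℝ) ≤ 4 * a * (Real.pi * Real.exp (4 * a)) := by rw [hcast, ← hY]; exact hk
    have h := xi_floor_twoPiece (2 * n) ha (by norm_num : (0 : ℝ) ≤ 1 / 40) hk' u hu hbu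
    rw [hcast] at h
    rw [hR, hcc, hRe]; exact h
  have hfloor' : ∀ u : ℝ, 0 < u → u < a - 1 / 40 → 16 * Real.pi ≤ 2 * (n : ℝ) / u ^ 2 +
      (deBruijnPhiDeriv u ^ 2 - deBruijnPhi u * deBruijnPhiDeriv₂ u) / deBruijnPhi u ^ 2 := by
    intro u hu _
    have h1 := xi_curvature_lower (2 * n) hu
    rw [hcast] at h1
    have h2 : (1 : ℝ) ≤ Real.exp (4 * u) := Real.one_le_exp (by linarith)
    have h3 := mul_le_mul_of_nonneg_left h2 (by positivity : (0 : ℝ) ≤ 16 * Real.pi)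
    linarith
  ---------------------------------------------------------------- the exponent and the left mass
  set Λ : ℝ := 2 * (n : ℝ) / (a - 1 / 80) ^ 2 +
    16 * Real.pi * Real.exp (4 * (a + 1 / 80)) * (1 + 1 / 10 ^ 6) with hΛ
  have hexp_twentieth : Real.exp (1 / 20) ≤ 20 / 19 := by
    have h : -(1 / 20 : ℝ) + 1 ≤ Real.exp (-(1 / 20)) := Real.add_one_le_exp _
    have e : Real.exp (1 / 20) * Real.exp (-(1 / 20)) = 1 := by rw [← Real.exp_add]; norm_num
    nlinarith [Real.exp_pos (1 / 20 : ℝ), Real.exp_pos (-(1 / 20) : ℝ)]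
  have hmon80 : a / (a - 1 / 80) ^ 2 ≤ (19 / 8) / (19 / 8 - 1 / 80) ^ 2 := by
    have h1 : 0 < (a - 1 / 80) ^ 2 := pow_pos (by linarith) 2
    rw [div_le_div_iff₀ h1 (by norm_num)]
    nlinarith [mul_nonneg (show (0:ℝ) ≤ a - 19 / 8 by linarith) (show (0:ℝ) ≤ a - 19 / 8 by linarith)]
  have hΛle : Λ ≤ (185446 / 10000) * Y := by
    have hpos : 0 < (a - 1 / 80) ^ 2 := pow_pos (by linarith) 2
    have h1 : 2 * (n : ℝ) / (a - 1 / 80) ^ 2 ≤ (17024 / 10000) * Y := by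
      calc 2 * (n : ℝ) / (a - 1 / 80) ^ 2 ≤ 4 * a * Y / (a - 1 / 80) ^ 2 :=
            div_le_div_of_nonneg_right hk hpos.le
        _ = 4 * Y * (a / (a - 1 / 80) ^ 2) := by ring
        _ ≤ 4 * Y * (4256 / 10000) := mul_le_mul_of_nonneg_left (hmon80.trans (by norm_num)) (by positivity)
        _ = (17024 / 10000) * Y := by ring
    have h2 : Real.exp (4 * (a + 1 / 80)) ≤ Real.exp (4 * a) * (20 / 19) := by
      have e : Real.exp (4 * (a + 1 / 80)) = Real.exp (4 * a) * Real.exp (1 / 20) := by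
        rw [← Real.exp_add]; congr 1; ring
      rw [e]; exact mul_le_mul_of_nonneg_left hexp_twentieth (Real.exp_pos _).le
    have h3 : 16 * Real.pi * Real.exp (4 * (a + 1 / 80)) * (1 + 1 / 10 ^ 6) ≤
        16 * (20 / 19) * (1 + 1 / 10 ^ 6) * Y := by
      calc 16 * Real.pi * Real.exp (4 * (a + 1 / 80)) * (1 + 1 / 10 ^ 6)
          = 16 * Real.pi * (1 + 1 / 10 ^ 6) * Real.exp (4 * (a + 1 / 80)) := by ring
        _ ≤ 16 * Real.pi * (1 + 1 / 10 ^ 6) * (Real.exp (4 * a) * (20 / 19)) :=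
            mul_le_mul_of_nonneg_left h2 (by positivity)
        _ = 16 * (20 / 19) * (1 + 1 / 10 ^ 6) * Y := by rw [hY]; ring
    have e : Λ = 2 * (n : ℝ) / (a - 1 / 80) ^ 2 +
        16 * Real.pi * Real.exp (4 * (a + 1 / 80)) * (1 + 1 / 10 ^ 6) := hΛ
    rw [e]; linarith
  -- `E = −Re/3200 + Λ/12800 ≤ −(3/1000)·Y ≤ −45`
  have hE : -(Re * (1 / 40) ^ 2 / 2) + Λ * (1 / 80) ^ 2 / 2 ≤ -(3 / 1000) * Y := by
    linarith only [hRege, hΛle, hYlo]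
  have hE45 : -(Re * (1 / 40) ^ 2 / 2) + Λ * (1 / 80) ^ 2 / 2 ≤ -45 := by linarith only [hE, hYlo]
  have hexp45 : Real.exp (-45) ≤ 120 / 45 ^ 5 := by
    have h := Real.pow_div_factorial_le_exp (45 : ℝ) (by norm_num) 5
    have h5 : ((Nat.factorial 5 : ℕ) : ℝ) = 120 := by norm_num [Nat.factorial]
    rw [h5] at h
    rw [Real.exp_neg, inv_eq_one_div, div_le_div_iff₀ (Real.exp_pos 45) (by norm_num)]
    linarith
  set eE : ℝ := Real.exp (-(Re * (1 / 40) ^ 2 / 2)) * Real.exp (Λ * (1 / 80) ^ 2 / 2) with heE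
  have heE0 : 0 < eE := by positivity
  have heE1 : eE ≤ 120 / 45 ^ 5 := by
    rw [heE, ← Real.exp_add]; exact (Real.exp_le_exp.2 hE45).trans hexp45
  -- `R⁷·eE ≤ 5900⁷·t⁷e^{−t} ≤ 5900⁷·70!/t⁶³ ≤ 1/160`, `t = 0.003·Y ≥ 123.9`, via `t⁷⁰/70! ≤ eᵗ`
  have hR7eE : eE * R ^ 7 ≤ 1 / 160 := by
    set t : ℝ := 3 / 1000 * Y with ht
    have ht0 : 0 < t := by positivity
    have htlo : (1239 / 10 : ℝ) ≤ t := by rw [ht]; linarith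
    have h1 : eE ≤ Real.exp (-t) := by
      rw [heE, ← Real.exp_add]; exact Real.exp_le_exp.2 (by rw [ht]; linarith)
    have h2 : R ^ 7 ≤ ((177 / 10) * Y) ^ 7 := pow_le_pow_left₀ hR0.le hRle 7
    have eY : (177 / 10) * Y = 5900 * t := by rw [ht]; ring
    rw [eY] at h2
    have h40 := Real.pow_div_factorial_le_exp t ht0.le 70
    have hfac : ((Nat.factorial 70 : ℕ) : ℝ) =
        11978571669969891796072783721689098736458938142546425857555362864628009582789845319680000000000000000 := by
      norm_num [Nat.factorial]
    rw [hfac] at h40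
    have h3 : Real.exp (-t) * t ^ 70 ≤
        11978571669969891796072783721689098736458938142546425857555362864628009582789845319680000000000000000 := by
      have hexp := Real.exp_pos t
      have h3' : t ^ 70 ≤ Real.exp t *
          11978571669969891796072783721689098736458938142546425857555362864628009582789845319680000000000000000 :=
        (div_le_iff₀ (by norm_num)).1 h40
      rw [Real.exp_neg, inv_mul_le_iff₀ hexp]; exact h3'
    have ht63 : ((1239 : ℝ) / 10) ^ 63 ≤ t ^ 63 := pow_le_pow_left₀ (by norm_num) htlo 63
    have ht63pos : (0 : ℝ) < (1239 / 10) ^ 63 := by positivity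
    calc eE * R ^ 7 ≤ Real.exp (-t) * (5900 * t) ^ 7 :=
          mul_le_mul h1 h2 (by positivity) (Real.exp_pos _).le
      _ = 5900 ^ 7 * (Real.exp (-t) * t ^ 70) / t ^ 63 := by
          have ht63ne : t ^ 63 ≠ 0 := pow_ne_zero _ ht0.ne'
          rw [eq_div_iff ht63ne]; ring
      _ ≤ 5900 ^ 7 *
          11978571669969891796072783721689098736458938142546425857555362864628009582789845319680000000000000000 /
          t ^ 63 := by
          gcongr
      _ ≤ 5900 ^ 7 *
          11978571669969891796072783721689098736458938142546425857555362864628009582789845319680000000000000000 /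
          (1239 / 10) ^ 63 :=
          div_le_div_of_nonneg_left (by positivity) ht63pos ht63
      _ ≤ 1 / 160 := by norm_num
  ---------------------------------------------------------------- `B`, the second-moment consequences
  have hP := xi_leftMass_le (2 * n) (s := 1 / 80) (τ := 1 / 40) (a := a) (by norm_num) (by norm_num)
    (by linarith) (by linarith) (by rw [hcast]; exact hmode)
  rw [hcast] at hP
  have hP' : (∫ u in Ioo 0 (a - 1 / 40), deBruijnPhi u * u ^ (2 * n)) / xiMoment (2 * n) ≤
      eE * 1600 / Re := by
    have h1 : (∫ u in Ioo 0 (a - 1 / 40), deBruijnPhi u * u ^ (2 * n)) / xiMoment (2 * n) ≤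
        eE / (2 * (1 / 80) * Re * (1 / 40)) := hP
    have e : eE / (2 * (1 / 80) * Re * (1 / 40)) = eE * 1600 / Re := by
      field_simp; ring
    rw [e] at h1
    exact h1
  have hRRe : R ≤ (6 / 5) * Re := by rw [hR]; linarith
  set B : ℝ := (1 + 1 / 5000) / R with hB
  have hB0 : 0 < B := by positivity
  have hBineq : R⁻¹ + (16 * Real.pi)⁻¹ *
      ((∫ u in Ioo 0 (a - 1 / 40), deBruijnPhi u * u ^ (2 * n)) / xiMoment (2 * n)) ≤ B := by
    have h1 : (16 * Real.pi)⁻¹ *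
        ((∫ u in Ioo 0 (a - 1 / 40), deBruijnPhi u * u ^ (2 * n)) / xiMoment (2 * n)) ≤
        (16 * Real.pi)⁻¹ * (eE * 1600 / Re) := mul_le_mul_of_nonneg_left hP' (by positivity)
    have hc : eE * 1600 * ((6 / 5) * Re) ≤ 16 * Real.pi * Re / 5000 := by
      have : eE * 1600 * (6 / 5) ≤ 16 * Real.pi / 5000 := by nlinarith only [heE1, hπ, heE0]
      nlinarith only [this, hRe0]
    have h2 : (16 * Real.pi)⁻¹ * (eE * 1600 / Re) ≤ (1 / 5000) / R := by
      rw [div_eq_mul_inv (1 / 5000) R, show (16 * Real.pi)⁻¹ * (eE * 1600 / Re) =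
        (eE * 1600) / (16 * Real.pi * Re) by field_simp]
      rw [div_le_iff₀ (by positivity), show 1 / 5000 * R⁻¹ * (16 * Real.pi * Re) =
        (16 * Real.pi * Re / 5000) / R by field_simp]
      rw [le_div_iff₀ hR0]
      calc eE * 1600 * R ≤ eE * 1600 * ((6 / 5) * Re) :=
            mul_le_mul_of_nonneg_left hRRe (by positivity)
        _ ≤ 16 * Real.pi * Re / 5000 := hc
    have e : B = R⁻¹ + (1 / 5000) / R := by rw [hB]; field_simp
    rw [e]; linarith
  have hBle : B ≤ (1 + 1 / 5000) / 219081 := by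
    rw [hB]; exact div_le_div_of_nonneg_left (by norm_num) (by norm_num) hRlo
  have hsqrtB : Real.sqrt B < 1 / 460 := by
    rw [show (1 / 460 : ℝ) = Real.sqrt ((1 / 460) ^ 2) by rw [Real.sqrt_sq (by norm_num)]]
    exact Real.sqrt_lt_sqrt hB0.le (by linarith)
  have hBa : Real.sqrt B < a := by linarith
  obtain ⟨hmean_lo', hmu⟩ := xiMu_two_le_of_curvature n ha hmode hR0
    (by positivity : (0 : ℝ) < 16 * Real.pi) hfloor hfloor' hBineq hBa
  have hmean_lo : a - 1 / 460 ≤ xiMean (2 * n) := by linarith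
  have hsq := sq_xiMean_sub_le (2 * n) ha (by rw [hcast]; exact hmode) hR0
    (by positivity : (0 : ℝ) < 16 * Real.pi) (by rw [hcast]; exact hfloor) (by rw [hcast]; exact hfloor') 
  have hmean_hi : xiMean (2 * n) ≤ a + 1 / 460 := by
    have h1 : (xiMean (2 * n) - a) ^ 2 ≤ B := hsq.trans hBineq
    have h2 : |xiMean (2 * n) - a| ≤ Real.sqrt B := by
      rw [← Real.sqrt_sq_eq_abs]; exact Real.sqrt_le_sqrt h1
    have := le_abs_self (xiMean (2 * n) - a); linarith
  -- the box inequality `(1 + 1/5000)(2n+1) ≤ (3/25)(a − 1/460)²·R`, hence `m̂ ≤ 3/25` and `μ₂ ≤ 3/25`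
  have hū0 : 0 < xiMean (2 * n) := xiMean_pos _
  have hmain : (1 + 1 / 5000) * (2 * (n : ℝ) + 1) ≤ 3 / 25 * (a - 1 / 460) ^ 2 * R := by
    -- `(a − 1/460) ≥ 0.9917·cc`
    have hratio : (988 / 1000) * cc ≤ a - 1 / 460 := by
      rw [hcc]
      have h16 : 1 / (16 * a) ≤ 1 / (16 * (19 / 8)) :=
        div_le_div_of_nonneg_left (by norm_num) (by norm_num) (by linarith)
      nlinarith [h16]
    have hr2 : (988 / 1000) ^ 2 * cc ^ 2 ≤ (a - 1 / 460) ^ 2 := by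
      rw [← mul_pow]; exact pow_le_pow_left₀ (by positivity) hratio 2
    -- `(a-s)² R = (a-s)² (2n/cc² + Re) ≥ 0.98347·2n + 14.4 (a-s)² Y`
    have hcc2 : 0 < cc ^ 2 := by positivity
    have h1 : (a - 1 / 460) ^ 2 * (2 * (n : ℝ) / cc ^ 2) ≥ (988 / 1000) ^ 2 * (2 * (n : ℝ)) := by
      have e : (a - 1 / 460) ^ 2 * (2 * (n : ℝ) / cc ^ 2) = (a - 1 / 460) ^ 2 / cc ^ 2 * (2 * n) := by
        field_simp
      rw [e]
      have h' : (988 / 1000 : ℝ) ^ 2 ≤ (a - 1 / 460) ^ 2 / cc ^ 2 := by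
        rw [le_div_iff₀ hcc2]; exact hr2
      exact mul_le_mul_of_nonneg_right h' (by positivity)
    have h2 : (a - 1 / 460) ^ 2 * Re ≥ (a - 1 / 460) ^ 2 * ((144 / 10) * Y) :=
      mul_le_mul_of_nonneg_left hRege (by positivity)
    -- the quadratic-beats-linear inequality in `a ≥ 19/8`
    have hq : (8 : ℝ) / 10 ≤ (1728 / 1000) * (a - 1 / 460) ^ 2 - (353226 / 100000) * a := by
      nlinarith [mul_nonneg (show (0:ℝ) ≤ a - 19 / 8 by linarith) (show (0:ℝ) ≤ a - 19 / 8 by linarith)]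
    have h3 : (8 : ℝ) / 10 * Y ≤ ((1728 / 1000) * (a - 1 / 460) ^ 2 - (353226 / 100000) * a) * Y :=
      mul_le_mul_of_nonneg_right hq hY0.le
    have e : 3 / 25 * (a - 1 / 460) ^ 2 * R =
        3 / 25 * ((a - 1 / 460) ^ 2 * (2 * (n : ℝ) / cc ^ 2)) + 3 / 25 * ((a - 1 / 460) ^ 2 * Re) := by
      rw [hR]; ring
    rw [e]
    nlinarith [h1, h2, h3, hkY, hYlo]
  have hmhat : (2 * (n : ℝ) + 1) ≤ 3 / 25 * xiMean (2 * n) ^ 2 * R := by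
    have h1 : (a - 1 / 460) ^ 2 ≤ xiMean (2 * n) ^ 2 := pow_le_pow_left₀ (by linarith) hmean_lo 2
    have h2 : 3 / 25 * (a - 1 / 460) ^ 2 * R ≤ 3 / 25 * xiMean (2 * n) ^ 2 * R := by
      have := mul_le_mul_of_nonneg_right h1 hR0.le; nlinarith only [this]
    nlinarith only [hmain, h2]
  have hμ2 : xiMu n 2 ≤ 3 / 25 := by
    have hlow : a - 1 / 460 ≤ a - Real.sqrt B := by linarith
    have hpos : 0 < a - 1 / 460 := by linarith
    have h1 : (2 * (n : ℝ) + 1) * B / (a - Real.sqrt B) ^ 2 ≤ (2 * (n : ℝ) + 1) * B / (a - 1 / 460) ^ 2 :=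
      div_le_div_of_nonneg_left (by positivity) (pow_pos hpos 2) (pow_le_pow_left₀ hpos.le hlow 2)
    have h2 : (2 * (n : ℝ) + 1) * B / (a - 1 / 460) ^ 2 ≤ 3 / 25 := by
      rw [div_le_iff₀ (pow_pos hpos 2), hB]
      rw [show (2 * (n : ℝ) + 1) * ((1 + 1 / 5000) / R) = (1 + 1 / 5000) * (2 * (n : ℝ) + 1) / R by ring,
        div_le_iff₀ hR0]
      linarith only [hmain]
    exact hmu.trans (h1.trans h2)
  ---------------------------------------------------------------- bulk: mean `c` and the Gaussian bounds
  set b : ℝ := a - 1 / 40 with hb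
  have hb0 : 0 < b := by rw [hb]; linarith
  set MJ : ℝ := ∫ u in Ici b, deBruijnPhi u * u ^ (2 * n) with hMJ
  have hsubJ : Ici b ⊆ Ioi (0 : ℝ) := fun u hu => lt_of_lt_of_le hb0 hu
  have hMJ0 : 0 < MJ := by
    have hint0 : IntegrableOn (fun u : ℝ => deBruijnPhi u * u ^ (2 * n)) (Ici b) :=
      (integrableOn_deBruijnPhi_mul_pow (2 * n)).mono_set hsubJ
    rw [hMJ, setIntegral_pos_iff_support_of_nonneg_ae
      (ae_restrict_of_forall_mem measurableSet_Ici fun u hu =>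
        (mul_pos (deBruijnPhi_pos_holds u) (pow_pos (hsubJ hu) _)).le) hint0]
    have hs' : Ici b ⊆ (Function.support fun u : ℝ => deBruijnPhi u * u ^ (2 * n)) ∩ Ici b :=
      fun u hu => ⟨(mul_pos (deBruijnPhi_pos_holds u) (pow_pos (hsubJ hu) _)).ne', hu⟩
    refine lt_of_lt_of_le ?_ (measure_mono hs')
    rw [Real.volume_Ici]; exact ENNReal.zero_lt_top
  set c : ℝ := (∫ u in Ici b, deBruijnPhi u * u ^ (2 * n) * u) / MJ with hc
  have hcMJ : MJ * c = ∫ u in Ici b, deBruijnPhi u * u ^ (2 * n) * u := by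
    rw [hc]; field_simp
  have hfloorN : ∀ u : ℝ, 0 < u → b ≤ u → R ≤ ((2 * n : ℕ) : ℝ) / u ^ 2 +
      (deBruijnPhiDeriv u ^ 2 - deBruijnPhi u * deBruijnPhiDeriv₂ u) / deBruijnPhi u ^ 2 := by
    intro u hu hbu; rw [hcast]; exact hfloor u hu hbu
  have hsR0 : 0 < Real.sqrt R := Real.sqrt_pos.2 hR0
  have hsRsq : Real.sqrt R ^ 2 = R := Real.sq_sqrt hR0.le
  -- even bulk bounds `γ = (2j-1)‼`
  have hEven : ∀ j : ℕ, j ≠ 0 →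
      ∫ u in Ici b, deBruijnPhi u * u ^ (2 * n) * |u - c| ^ (2 * j) ≤
        (((2 * j - 1 : ℕ)‼ : ℕ) : ℝ) * MJ / Real.sqrt R ^ (2 * j) := by
    intro j hj
    have h := xi_bulkEvenMoment_le (2 * n) hj hb0 hR0 hfloorN hcMJ
    have e1 : (fun u : ℝ => deBruijnPhi u * u ^ (2 * n) * |u - c| ^ (2 * j)) =
        fun u => deBruijnPhi u * u ^ (2 * n) * (u - c) ^ (2 * j) := by
      funext u; rw [(even_two_mul j).pow_abs]
    rw [e1, sqrt_pow_two_mul hR0.le]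
    calc ∫ u in Ici b, deBruijnPhi u * u ^ (2 * n) * (u - c) ^ (2 * j)
        ≤ (((2 * j - 1 : ℕ)‼ : ℕ) : ℝ) / R ^ j * MJ := h
      _ = _ := by rw [hMJ]; ring
  -- odd bulk bounds by AM–GM with `t = q/√R`
  have hOdd : ∀ j : ℕ, j ≠ 0 → ∀ q : ℝ, 0 < q →
      ∫ u in Ici b, deBruijnPhi u * u ^ (2 * n) * |u - c| ^ (2 * j + 1) ≤
        ((q * (((2 * j - 1 : ℕ)‼ : ℕ) : ℝ) + (((2 * (j + 1) - 1 : ℕ)‼ : ℕ) : ℝ) / q) / 2) * MJ /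
          Real.sqrt R ^ (2 * j + 1) := by
    intro j hj q hq
    have ht : 0 < q / Real.sqrt R := div_pos hq hsR0
    have h := xi_bulkOddMoment_le (2 * n) hj hb0 hR0 ht hfloorN hcMJ
    refine h.trans (le_of_eq ?_)
    rw [hMJ]
    have hsRne : Real.sqrt R ≠ 0 := hsR0.ne'
    have hqne : q ≠ 0 := hq.ne'
    have e2 : Real.sqrt R ^ (2 * j + 1) = R ^ j * Real.sqrt R := by
      rw [pow_succ, sqrt_pow_two_mul hR0.le]
    have e3 : R ^ (j + 1) = R ^ j * (Real.sqrt R * Real.sqrt R) := by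
      rw [pow_succ, ← sq, hsRsq]
    rw [e2, e3]
    field_simp
  ---------------------------------------------------------------- left pieces `I_j ≤ ε (D + 40j/R)^j M / R`
  -- the potential vocabulary of `XiTiltedPotential.lean`
  have hmodeV : xiPotentialDeriv (((2 * n : ℕ) : ℝ)) a = 0 := by
    rw [hcast]; unfold xiPotentialDeriv phiNegLogDeriv; rw [neg_div]; linarith [hmode]
  have hsubI : Icc b a ⊆ Ioi (0 : ℝ) := fun u hu => lt_of_lt_of_le hb0 hu.1
  have hba : b < a := by rw [hb]; linarith
  have hρV : ∀ x ∈ Icc b a, R ≤ xiPotentialDeriv₂ (((2 * n : ℕ) : ℝ)) x := by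
    intro x hx
    have hx0 : 0 < x := hsubI hx
    have h := hfloor x hx0 hx.1
    unfold xiPotentialDeriv₂ phiNegLogDeriv₂
    rw [hcast]; exact h
  have hM := xiMoment_pos (2 * n)
  have hnorm := xiMoment_ge_window (2 * n) (s := 1 / 80) (a := a) (Λ := Λ) (by norm_num) (by linarith)
    (by rw [hcast]; exact hmode) (by
      intro u hu
      have hu0 : 0 < u := by linarith [hu.1]
      have hu32 : (3 : ℝ) / 2 ≤ u := by linarith [hu.1]
      have hV := deBruijnPhi_logConcave_upper_div hu32
      have h1 : ((2 * n : ℕ) : ℝ) / u ^ 2 ≤ 2 * (n : ℝ) / (a - 1 / 80) ^ 2 := by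
        rw [hcast]; exact div_le_div_of_nonneg_left (by positivity) (pow_pos (by linarith) 2)
          (pow_le_pow_left₀ (by linarith) hu.1 2)
      have h2 : Real.exp (4 * u) ≤ Real.exp (4 * (a + 1 / 80)) := Real.exp_le_exp.2 (by linarith [hu.2])
      have h3 := mul_le_mul_of_nonneg_left h2 (by positivity : (0 : ℝ) ≤ 16 * Real.pi * (1 + 1 / 10 ^ 6))
      rw [hΛ]; nlinarith)
  have hI : ∀ j : ℕ, j ≤ 16 →
      ∫ u in Ioo 0 (a - 1 / 40), deBruijnPhi u * u ^ (2 * n) * ((1 / 40 + 1 / 460) + ((a - 1 / 40) - u)) ^ j ≤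
        (1600 * eE) * ((1 / 40 + 1 / 460) + 40 * j / R) ^ j / R * xiMoment (2 * n) := by
    intro j _
    have hD0 : (0 : ℝ) ≤ 1 / 40 + 1 / 460 := by norm_num
    have htail := setIntegral_add_sub_pow_mul_exp_neg_le_of_curvature_floor (D := Ioi 0)
      (S := Ioo 0 b) (g := xiPotential (((2 * n : ℕ) : ℝ))) (g₁ := xiPotentialDeriv (((2 * n : ℕ) : ℝ)))
      (g₂ := xiPotentialDeriv₂ (((2 * n : ℕ) : ℝ))) (ρ := R) hba hR0
      (convexOn_xiPotential (by positivity)) hsubI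
      (fun x hx => hasDerivAt_xiPotential _ (hsubI hx).ne')
      (fun x hx => hasDerivAt_xiPotentialDeriv _ (hsubI hx).ne') hρV hmodeV hD0
      (fun u hu => ⟨Ioo_subset_Ioi_self hu, hu.2⟩) measurableSet_Ioo j
    -- convert the integrand and `e^{-W(a)}`
    have e1 : ∫ u in Ioo 0 b, ((1 / 40 + 1 / 460) + (b - u)) ^ j *
        Real.exp (-xiPotential (((2 * n : ℕ) : ℝ)) u) =
        ∫ u in Ioo 0 b, deBruijnPhi u * u ^ (2 * n) * ((1 / 40 + 1 / 460) + (b - u)) ^ j := by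
      refine setIntegral_congr_fun measurableSet_Ioo fun u hu => ?_
      simp only [exp_neg_xiPotential_natCast (2 * n) hu.1]; ring
    have e2 : Real.exp (-xiPotential (((2 * n : ℕ) : ℝ)) a) = a ^ (2 * n) * deBruijnPhi a :=
      exp_neg_xiPotential_natCast (2 * n) ha
    have e3 : a - b = 1 / 40 := by rw [hb]; ring
    rw [e1, e2, e3] at htail
    have hsum := tailSum_le j hD0 (by positivity : (0 : ℝ) < R * (1 / 40))
    have e4 : ((1 : ℝ) / 40 + 1 / 460 + j / (R * (1 / 40))) ^ j / (R * (1 / 40)) =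
        (1 / 40 + 1 / 460 + 40 * j / R) ^ j * (40 / R) := by
      field_simp
    rw [e4] at hsum
    -- normaliser: `a^{2n}Φ(a) ≤ 40·e^{Λ/12800}·M`
    have hΦa : 0 < a ^ (2 * n) * deBruijnPhi a := mul_pos (pow_pos ha _) (deBruijnPhi_pos_holds a)
    have hnorm' : a ^ (2 * n) * deBruijnPhi a ≤
        40 * Real.exp (Λ * (1 / 80) ^ 2 / 2) * xiMoment (2 * n) := by
      have e5 : Real.exp (-(Λ * (1 / 80) ^ 2 / 2)) * Real.exp (Λ * (1 / 80) ^ 2 / 2) = 1 := by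
        rw [← Real.exp_add]; simp
      have h := mul_le_mul_of_nonneg_right hnorm (Real.exp_pos (Λ * (1 / 80) ^ 2 / 2)).le
      have e6 : 2 * (1 / 80) * (deBruijnPhi a * a ^ (2 * n) * Real.exp (-(Λ * (1 / 80) ^ 2 / 2))) *
          Real.exp (Λ * (1 / 80) ^ 2 / 2) = (1 / 40) * (a ^ (2 * n) * deBruijnPhi a) := by
        rw [show 2 * (1 / 80) * (deBruijnPhi a * a ^ (2 * n) * Real.exp (-(Λ * (1 / 80) ^ 2 / 2))) *
          Real.exp (Λ * (1 / 80) ^ 2 / 2) = 2 * (1 / 80) * (deBruijnPhi a * a ^ (2 * n)) *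
          (Real.exp (-(Λ * (1 / 80) ^ 2 / 2)) * Real.exp (Λ * (1 / 80) ^ 2 / 2)) by ring, e5]
        ring
      rw [e6] at h
      linarith
    calc ∫ u in Ioo 0 b, deBruijnPhi u * u ^ (2 * n) * (1 / 40 + 1 / 460 + (b - u)) ^ j
        ≤ a ^ (2 * n) * deBruijnPhi a * Real.exp (-(R * (1 / 40) ^ 2 / 2)) *
            ∑ m ∈ range (j + 1), (1 / 40 + 1 / 460) ^ m *
              ((((j - m) ! : ℕ) : ℝ) / (R * (1 / 40)) ^ (j - m + 1)) * (j.choose m : ℝ) := htail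
      _ ≤ a ^ (2 * n) * deBruijnPhi a * Real.exp (-(R * (1 / 40) ^ 2 / 2)) *
            ((1 / 40 + 1 / 460 + 40 * j / R) ^ j * (40 / R)) :=
          mul_le_mul_of_nonneg_left hsum (by positivity)
      _ ≤ (40 * Real.exp (Λ * (1 / 80) ^ 2 / 2) * xiMoment (2 * n)) *
            Real.exp (-(R * (1 / 40) ^ 2 / 2)) * ((1 / 40 + 1 / 460 + 40 * j / R) ^ j * (40 / R)) := by
          gcongr
      _ ≤ (40 * Real.exp (Λ * (1 / 80) ^ 2 / 2) * xiMoment (2 * n)) *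
            Real.exp (-(Re * (1 / 40) ^ 2 / 2)) * ((1 / 40 + 1 / 460 + 40 * j / R) ^ j * (40 / R)) := by
          apply mul_le_mul_of_nonneg_right _ (by positivity)
          apply mul_le_mul_of_nonneg_left _ (by positivity)
          exact Real.exp_le_exp.2 (by linarith only [hReR])
      _ = (1600 * eE) * ((1 / 40 + 1 / 460) + 40 * j / R) ^ j / R * xiMoment (2 * n) := by
          rw [heE]; ring
  ---------------------------------------------------------------- the faces
  have hε0 : 0 ≤ 1600 * eE := by positivity
  have hε : 1600 * eE ≤ 1 / 960 := by
    have h' : (1600 : ℝ) * (120 / 45 ^ 5) ≤ 1 / 960 := by norm_num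
    linarith only [heE1, h']
  have hεR : 1600 * eE * R ^ 7 ≤ 10 := by linarith only [hR7eE]
  have face : ∀ l : ℕ, 3 ≤ l → l ≤ 16 → ∀ γ : ℝ, 0 ≤ γ →
      (∫ u in Ici (a - 1 / 40), deBruijnPhi u * u ^ (2 * n) * |u - c| ^ l ≤
        γ * (∫ u in Ici (a - 1 / 40), deBruijnPhi u * u ^ (2 * n)) / Real.sqrt R ^ l) →
      |xiMu n l| ≤ Real.sqrt (3 / 25) ^ l * (γ * (10 / 9) ^ (l - 1)) + 1 / 50000 :=
    fun l hl3 hl8 γ hγ hbulk =>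
      xi_face_bound_sixteen n l hl3 hl8 (m := 3 / 25) (by norm_num) (by norm_num) hαa' hRlo hγ hε0 hε
        hεR hmean_lo hmean_hi hmhat hcMJ hbulk hI
  -- numerics on `q = √(3/25)`
  set q : ℝ := Real.sqrt (3 / 25) with hq
  have hq0 : 0 ≤ q := Real.sqrt_nonneg _
  have hqsq : q ^ 2 = 3 / 25 := Real.sq_sqrt (by norm_num)
  have hqlo : (3464 : ℝ) / 10000 ≤ q := by
    rw [hq, show (3464 / 10000 : ℝ) = Real.sqrt ((3464 / 10000) ^ 2) by rw [Real.sqrt_sq (by norm_num)]]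
    exact Real.sqrt_le_sqrt (by norm_num)
  have hq3 : q ^ 3 = 3 / 25 * q := by rw [pow_succ, hqsq]
  have hq4 : q ^ 4 = (3 / 25) ^ 2 := by rw [show (4:ℕ) = 2 * 2 from rfl, pow_mul, hqsq]
  have hq5 : q ^ 5 = (3 / 25) ^ 2 * q := by rw [pow_succ, hq4]
  have hq6 : q ^ 6 = (3 / 25) ^ 3 := by rw [show (6:ℕ) = 2 * 3 from rfl, pow_mul, hqsq]
  have hq7 : q ^ 7 = (3 / 25) ^ 3 * q := by rw [pow_succ, hq6]
  have hq8 : q ^ 8 = (3 / 25) ^ 4 := by rw [show (8:ℕ) = 2 * 4 from rfl, pow_mul, hqsq]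
  have hq9 : q ^ 9 = (3 / 25) ^ 4 * q := by rw [pow_succ, hq8]
  have hq10 : q ^ 10 = (3 / 25) ^ 5 := by rw [show (10:ℕ) = 2 * 5 from rfl, pow_mul, hqsq]
  -- the six faces
  have hdf1 : (((2 * 1 - 1 : ℕ)‼ : ℕ) : ℝ) = 1 := by norm_num [Nat.doubleFactorial]
  have hdf2 : (((2 * 2 - 1 : ℕ)‼ : ℕ) : ℝ) = 3 := by norm_num [Nat.doubleFactorial]
  have hdf3 : (((2 * 3 - 1 : ℕ)‼ : ℕ) : ℝ) = 15 := by norm_num [Nat.doubleFactorial]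
  have hdf4 : (((2 * 4 - 1 : ℕ)‼ : ℕ) : ℝ) = 105 := by norm_num [Nat.doubleFactorial]
  have hdf2' : (((2 * (1 + 1) - 1 : ℕ)‼ : ℕ) : ℝ) = 3 := by norm_num [Nat.doubleFactorial]
  have hdf3' : (((2 * (2 + 1) - 1 : ℕ)‼ : ℕ) : ℝ) = 15 := by norm_num [Nat.doubleFactorial]
  have hdf4' : (((2 * (3 + 1) - 1 : ℕ)‼ : ℕ) : ℝ) = 105 := by norm_num [Nat.doubleFactorial]
  have hdf5 : (((2 * 5 - 1 : ℕ)‼ : ℕ) : ℝ) = 945 := by norm_num [Nat.doubleFactorial]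
  have hdf5' : (((2 * (4 + 1) - 1 : ℕ)‼ : ℕ) : ℝ) = 945 := by norm_num [Nat.doubleFactorial]
  have f3 : |xiMu n 3| ≤ q ^ 3 * ((97 / 56) * (10 / 9) ^ 2) + 1 / 50000 := by
    have h := hOdd 1 one_ne_zero (7 / 4) (by norm_num)
    rw [hdf1, hdf2'] at h
    have h' := face 3 (by norm_num) (by norm_num) (97 / 56) (by norm_num) (by
      have e : ((7 / 4 : ℝ) * 1 + 3 / (7 / 4)) / 2 = 97 / 56 := by norm_num
      rw [e] at h; exact h)
    simpa using h'
  have f4 : |xiMu n 4| ≤ q ^ 4 * (3 * (10 / 9) ^ 3) + 1 / 50000 := by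
    have h := hEven 2 two_ne_zero
    rw [hdf2] at h
    simpa using face 4 (by norm_num) (by norm_num) 3 (by norm_num) h
  have f5 : |xiMu n 5| ≤ q ^ 5 * ((161 / 24) * (10 / 9) ^ 4) + 1 / 50000 := by
    have h := hOdd 2 two_ne_zero (9 / 4) (by norm_num)
    rw [hdf2, hdf3'] at h
    have h' := face 5 (by norm_num) (by norm_num) (161 / 24) (by norm_num) (by
      have e : ((9 / 4 : ℝ) * 3 + 15 / (9 / 4)) / 2 = 161 / 24 := by norm_num
      rw [e] at h; exact h)
    simpa using h'
  have f6 : |xiMu n 6| ≤ q ^ 6 * (15 * (10 / 9) ^ 5) + 1 / 50000 := by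
    have h := hEven 3 (by norm_num)
    rw [hdf3] at h
    simpa using face 6 (by norm_num) (by norm_num) 15 (by norm_num) h
  have f7 : |xiMu n 7| ≤ q ^ 7 * ((516 / 13) * (10 / 9) ^ 6) + 1 / 50000 := by
    have h := hOdd 3 (by norm_num) (13 / 5) (by norm_num)
    rw [hdf3, hdf4'] at h
    have h' := face 7 (by norm_num) (by norm_num) (516 / 13) (by norm_num) (by
      have e : ((13 / 5 : ℝ) * 15 + 105 / (13 / 5)) / 2 = 516 / 13 := by norm_num
      rw [e] at h; exact h)
    simpa using h'
  have f8 : |xiMu n 8| ≤ q ^ 8 * (105 * (10 / 9) ^ 7) + 1 / 50000 := by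
    have h := hEven 4 (by norm_num)
    rw [hdf4] at h
    simpa using face 8 (by norm_num) (by norm_num) 105 (by norm_num) h
  have f9 : |xiMu n 9| ≤ q ^ 9 * (315 * (10 / 9) ^ 8) + 1 / 50000 := by
    have h := hOdd 4 (by norm_num) 3 (by norm_num)
    rw [hdf4, hdf5'] at h
    have h' := face 9 (by norm_num) (by norm_num) 315 (by norm_num) (by
      have e : ((3 : ℝ) * 105 + 945 / 3) / 2 = 315 := by norm_num
      rw [e] at h; exact h)
    simpa using h'
  have f10 : |xiMu n 10| ≤ q ^ 10 * (945 * (10 / 9) ^ 9) + 1 / 50000 := by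
    have h := hEven 5 (by norm_num)
    rw [hdf5] at h
    simpa using face 10 (by norm_num) (by norm_num) 945 (by norm_num) h
  rw [hq3] at f3; rw [hq4] at f4; rw [hq5] at f5; rw [hq6] at f6; rw [hq7] at f7; rw [hq8] at f8
  rw [hq9] at f9; rw [hq10] at f10
  ---------------------------------------------------------------- packaging
  refine ⟨deltaOne_le_of_le (by norm_num) (by norm_num) hn, xiMu_nonneg_of_even n even_two, ?_, ?_⟩
  · push_cast; exact hμ2
  intro l hl3 hl8
  have hl8' : l ≤ 10 := by omega
  interval_cases l
  · refine ⟨fun h => absurd h (by decide), fun _ => ?_⟩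
    push_cast; rw [← hq]; norm_num [blLadderConst]; linarith only [f3, hqlo, hq0]
  · refine ⟨fun _ => ⟨xiMu_nonneg_of_even n (by decide), ?_⟩, fun h => absurd h (by decide)⟩
    push_cast; norm_num [blLadderConst]; linarith only [f4, le_abs_self (xiMu n 4)]
  · refine ⟨fun h => absurd h (by decide), fun _ => ?_⟩
    push_cast; rw [← hq]; norm_num [blLadderConst]; linarith only [f5, hqlo, hq0]
  · refine ⟨fun _ => ⟨xiMu_nonneg_of_even n (by decide), ?_⟩, fun h => absurd h (by decide)⟩
    push_cast; norm_num [blLadderConst]; linarith only [f6, le_abs_self (xiMu n 6)]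
  · refine ⟨fun h => absurd h (by decide), fun _ => ?_⟩
    push_cast; rw [← hq]; norm_num [blLadderConst]; linarith only [f7, hqlo, hq0]
  · refine ⟨fun _ => ⟨xiMu_nonneg_of_even n (by decide), ?_⟩, fun h => absurd h (by decide)⟩
    push_cast; norm_num [blLadderConst]; linarith only [f8, le_abs_self (xiMu n 8)]
  · refine ⟨fun h => absurd h (by decide), fun _ => ?_⟩
    push_cast; rw [← hq]; norm_num [blLadderConst]; linarith only [f9, hqlo, hq0]
  · refine ⟨fun _ => ⟨xiMu_nonneg_of_even n (by decide), ?_⟩, fun h => absurd h (by decide)⟩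
    push_cast; norm_num [blLadderConst]; linarith only [f10, le_abs_self (xiMu n 10)]

/-- **COROLLARY (GORZ Thm 3 mechanism at `d = 5`, height-free from `2·10⁵`).** The degree-`5` Jensen
polynomials of the Taylor coefficients of `ξ` are hyperbolic for every shift `n ≥ 2·10⁵` —
unconditionally. [cite: GORZPNAS2019, Thm 3] -/
theorem jensenHyperbolicFrom_xi_five_twoHundredThousand : JensenHyperbolicFrom xiTaylorCoeff 5 200000 :=
  jensenHyperbolicFrom_five_of_ladderMomentBounds_from fun n hn => ladderMomentBounds_five_of_ge n hn

end Literature.NumberTheory.LFunctions
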